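import Summits.Ventures.HodgeRepro2.T7SupportWeightTorusOrbital

/-!
# The two-torus orbital integral of a ONE-vector coefficient (support, seat p1)

t7-crit-1's dictionary objection (STATUS l. 15122): the model rows `T7SupportWeightTorusOrbital` /
`…RegularPoint` evaluate the bi-torus orbital integral of the TWO-vector coefficient `g ↦ ⟪x_A, τ(g) x_B⟫`
(`x_B = τ(h) x_A` a weight vector of the second torus), while the self-adjointness `f* = f` of
`T7SupportIntegratedForm` holds for the ONE-vector coefficient `f(g) = ⟪v, τ(g) v⟫`. This file evaluates the
orbital integral of the one-vector coefficient, for `v` a weight vector of the FIRST torus only: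

  `∫_K ∫_K ⟪v, τ(ρ_A(u) γ h ρ_B(w) h⁻¹) v⟫ · u^p · conj(w^q) = [a + p = 0] · Φ_q(γ)`,
  `Φ_q(γ) := ∫_K conj(w^q) · ⟪v, τ(γ h ρ_B(w) h⁻¹) v⟫ dw`   (`torus_orbital_one_vector_eq`, `fourierCoeff`):

the first torus collapses to the bracket as before, the second torus integral is the `q`-th FOURIER COEFFICIENT of
`w ↦ ⟪v, τ(γ h ρ_B(w) h⁻¹) v⟫` — at `γ = 1`, of the `T_B`-matrix coefficient of `v` (the `(T_B, q)`-weight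
component of `v`: `⟪v, P_q v⟫ = ‖P_q v‖²`). So, with the one-vector `f`, «`a_{γ₀} ≠ 0`» at `γ₀ = 1` is exactly the
hypothesis «`v` has a non-zero `(T_B, q)`-component» (`torus_orbital_one_vector_at_one_ne_zero`), and `γ₀ = 1` is
REGULAR as soon as `h ∉ K` (`κ(1) = |h₀₀|² ≠ 1` — `T7SupportKappaCartan.kappa_eq_one_iff 1 h` /
`T7SupportCompactRegularPoint.kappa_eq_one_iff 1 h`: no curve, no continuity). In the line: `v = u_A`, the component
is `⟨u_B, u_A⟩ ≠ 0` for the `T_B`-weight vector `u_B` when the weight space is a line — the content of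
L3-ARGUMENT §4a's Fock computation, now a displayed hypothesis of one kernel lemma. `f* = f` for the one-vector
coefficient is `adjointFn_coeff_self` (`conj ⟪v, τ(g⁻¹) v⟫ = ⟪v, τ(g) v⟫` by unitarity).

Nothing here is about any specific group, the adelic group, or any period.
Blind lane: Mathlib + the HodgeRepro2 prefix only; no sorry; axioms ⊆ {propext, Classical.choice, Quot.sound}.
-/

namespace Summit.Ventures.HodgeRepro2.T7SupportOneVectorOrbital

open MeasureTheory
open scoped InnerProductSpace
open T5HaarCircle T7SupportWeightTorusOrbital

variable {G : Type*} [Group G] {V : Type*} [NormedAddCommGroup V] [InnerProductSpace ℂ V]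

/-- **the one-vector coefficient is symmetric**: `conj ⟪v, τ(g⁻¹) v⟫ = ⟪v, τ(g) v⟫` for a unitary `τ` -/
theorem adjointFn_coeff_self {τ : G →* (V →ₗ[ℂ] V)} (hτ : IsUnitaryRep τ) (v : V) (g : G) :
    (starRingEnd ℂ) (coeff τ v v g⁻¹) = coeff τ v v g := by
  unfold coeff
  rw [inner_conj_symm]
  exact (inner_apply_eq_inner_inv hτ g v v).symm

/-- the first-torus equivariance of a one-vector coefficient with `v` a weight vector of `ρ_A` -/
theorem coeff_torus_mul {τ : G →* (V →ₗ[ℂ] V)} (hτ : IsUnitaryRep τ) {ρA : Circle →* G} {a : ℤ} {v : V}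
    (hA : IsWeightVector τ ρA a v) (u : Circle) (g : G) :
    coeff τ v v (ρA u * g) = (u : ℂ) ^ a * coeff τ v v g := by
  unfold coeff
  rw [map_mul, Module.End.mul_apply, inner_apply_eq_inner_inv hτ, ← map_inv, hA u⁻¹, inner_smul_left,
    conj_inv_zpow]

variable [MeasurableSpace Circle] [BorelSpace Circle]

/-- the `q`-th Fourier coefficient of `w ↦ ⟪v, τ(γ h ρ_B(w) h⁻¹) v⟫` -/
noncomputable def fourierCoeff (τ : G →* (V →ₗ[ℂ] V)) (v : V) (h : G) (ρB : Circle →* G) (q : ℤ) (γ : G) : ℂ :=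
  ∫ w : Circle, (starRingEnd ℂ) ((w : ℂ) ^ q) * coeff τ v v (γ * (h * ρB w * h⁻¹)) ∂haarCircle

omit [BorelSpace Circle] in
/-- the inner integral (over the second torus) of the one-vector coefficient -/
theorem inner_integral_one_vector {τ : G →* (V →ₗ[ℂ] V)} (hτ : IsUnitaryRep τ) {ρA : Circle →* G} {a : ℤ}
    {v : V} (hA : IsWeightVector τ ρA a v) (h : G) (ρB : Circle →* G) (u : Circle) (γ : G) (p q : ℤ) :
    ∫ w : Circle, coeff τ v v (ρA u * γ * (h * ρB w * h⁻¹)) * ((u : ℂ) ^ p * (starRingEnd ℂ) ((w : ℂ) ^ q))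
        ∂haarCircle = (u : ℂ) ^ (a + p) * fourierCoeff τ v h ρB q γ := by
  have e : ∀ w : Circle,
      coeff τ v v (ρA u * γ * (h * ρB w * h⁻¹)) * ((u : ℂ) ^ p * (starRingEnd ℂ) ((w : ℂ) ^ q)) =
      (u : ℂ) ^ (a + p) * ((starRingEnd ℂ) ((w : ℂ) ^ q) * coeff τ v v (γ * (h * ρB w * h⁻¹))) := by
    intro w
    rw [mul_assoc (ρA u) γ, coeff_torus_mul hτ hA u, zpow_add₀ (Circle.coe_ne_zero u)]
    ring
  simp_rw [e]
  rw [integral_const_mul]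
  rfl

/-- **the two-torus orbital integral of a one-vector coefficient**:
`∫∫ ⟪v, τ(ρ_A(u) γ h ρ_B(w) h⁻¹) v⟫ u^p conj(w^q) = [a + p = 0] · Φ_q(γ)`. -/
theorem torus_orbital_one_vector_eq {τ : G →* (V →ₗ[ℂ] V)} (hτ : IsUnitaryRep τ) {ρA : Circle →* G} {a : ℤ}
    {v : V} (hA : IsWeightVector τ ρA a v) (h : G) (ρB : Circle →* G) (γ : G) (p q : ℤ) :
    ∫ u : Circle, ∫ w : Circle,
        coeff τ v v (ρA u * γ * (h * ρB w * h⁻¹)) * ((u : ℂ) ^ p * (starRingEnd ℂ) ((w : ℂ) ^ q))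
        ∂haarCircle ∂haarCircle =
      (if a + p = 0 then 1 else 0) * fourierCoeff τ v h ρB q γ := by
  simp_rw [inner_integral_one_vector hτ hA h ρB _ γ p q]
  have e : ∀ u : Circle, (u : ℂ) ^ (a + p) * fourierCoeff τ v h ρB q γ =
      fourierCoeff τ v h ρB q γ * ((u : ℂ) ^ (a + p) * (starRingEnd ℂ) ((u : ℂ) ^ (0 : ℤ))) := by
    intro u
    simp only [zpow_zero, map_one, mul_one]
    ring
  simp_rw [e]
  rw [integral_const_mul, integral_zpow_mul_conj_zpow]
  ring

omit [BorelSpace Circle] in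
/-- at `γ = 1` the Fourier coefficient is the `q`-th Fourier coefficient of the `T_B`-matrix coefficient of `v`
(`T_B = h ρ_B h⁻¹`) -/
theorem fourierCoeff_one (τ : G →* (V →ₗ[ℂ] V)) (v : V) (h : G) (ρB : Circle →* G) (q : ℤ) :
    fourierCoeff τ v h ρB q 1 =
      ∫ w : Circle, (starRingEnd ℂ) ((w : ℂ) ^ q) * coeff τ v v (h * ρB w * h⁻¹) ∂haarCircle := by
  unfold fourierCoeff
  simp only [one_mul]

/-- **«`a_{γ₀} ≠ 0` at `γ₀ = 1` for the one-vector coefficient is the non-vanishing of the `(T_B, q)`-component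
of `v`»**: with matching first-torus character `p = −a`, the orbital integral at `γ = 1` is the `q`-th Fourier
coefficient of `w ↦ ⟪v, τ(h ρ_B(w) h⁻¹) v⟫`, and it is non-zero iff that coefficient is. -/
theorem torus_orbital_one_vector_at_one_ne_zero {τ : G →* (V →ₗ[ℂ] V)} (hτ : IsUnitaryRep τ)
    {ρA : Circle →* G} {a : ℤ} {v : V} (hA : IsWeightVector τ ρA a v) (h : G) (ρB : Circle →* G) (q : ℤ)
    (hq : ∫ w : Circle, (starRingEnd ℂ) ((w : ℂ) ^ q) * coeff τ v v (h * ρB w * h⁻¹) ∂haarCircle ≠ 0) :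
    ∫ u : Circle, ∫ w : Circle,
        coeff τ v v (ρA u * 1 * (h * ρB w * h⁻¹)) * ((u : ℂ) ^ (-a) * (starRingEnd ℂ) ((w : ℂ) ^ q))
        ∂haarCircle ∂haarCircle ≠ 0 := by
  rw [torus_orbital_one_vector_eq hτ hA h ρB 1 (-a) q, if_pos (by ring), one_mul, fourierCoeff_one]
  exact hq

end Summit.Ventures.HodgeRepro2.T7SupportOneVectorOrbital
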